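import Literature.NumberTheory.Rogawski1990.ArchCentralLimitChamberJetLimit   -- ★ p843566 (this seat): the jet-limit sockets (`of_chamberJetLimits` ∕ `…JetBounds`), `convex_chamber`; brings ★ p843009 ∕ p842935 (chambers)
import HarnessLib

/-!
# FROM THE WALL TO THE CORNER: a limit from inside a chamber is computed along ANY curve in `closure(chamber) ∩ W` on which the function is continuous — the adapter between ROAD A's
# compact-wall values ((A4): `lim_{v→u} ωF_Θ(k_v)`) and the corner sockets of the N1 skeleton (Rogawski 1990 §8.4 p. 126; Warner II §8.5.1)

Topic `NumberTheory/Rogawski1990`; namespace `Literature.NumberTheory.Rogawski1990` (§1 generic topology in `Literature.Topology`).  THEOREMS ONLY (no `def`, no instance, no notation, no axiom,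
no named fact, no `sorry`).  Cell `pub/hodgecm-mathlib`, ENGINE T1 (crux H413 = `stmt-HodgeConjecture-24833`); ROAD-Sd, «SdArch» ED. 3's ONE open stub N1 = `stub_ArchCentralLimitU21` (ROAD A, owner
F0P3a-p05 (g13)); the N1 ASSEMBLY SKELETON (α1), F0P3a-p02 (g12), census `CENSUS-A6-InHouseScoping` 1a1738eb §4.

THE POINT.  The sockets ★ `of_chamberJetLimits`∕`of_chamberJetBounds` (and, through ★ `tendsto_iteratedFDeriv_nhdsWithin_chamber_of_cornerExtension`, the extension sockets) ask for the VALUE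
of a limit `J = lim_{θ→0, θ∈C_σ} D³(F_Θ∘chart)(θ)` (or of `lim_{C_σ} ωF_Θ`); ROAD A's (A4) files compute limits ALONG THE COMPACT WALL `v ↦ k_v`, a curve in the CLOSURE of the compact
double-chamber, on which `F_Θ` (hence `ωF_Θ`, `D³F_Θ`) is continuous by (A1) (smooth across the compact wall, ★ p842196).  §1 **`tendsto_nhdsWithin_closure_inter_of_continuousOn`** (generic):
if `g → J` along `𝓝[C] x` and `g` is continuous on an open `W`, then `g → J` along `𝓝[closure C ∩ W] x` — so along every curve `γ → x` that stays in `closure C ∩ W` (**`tendsto_comp_curve_of_…`**).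
§2 `mem_closure_chamber_of_le`: every weakly ordered angle vector `θ(σ0) ≤ θ(σ1) ≤ θ(σ2)` — in particular every wall point — lies in `closure C_σ`.  Consequence for the D-chambers: with
`g := ωF_Θ` (or `D³(F_Θ∘chart)`) on `W :=` the (A1) block-separated open set, `J`'s value IS the (A4) wall limit; no extension theorem, no uniformity beyond the socket's own hypothesis.
HONEST LABEL: HC_CM is proved only modulo the printed citations until rung 0 closes; bookkeeping, pays nothing by itself.

## References
* [Rogawski1990] J. D. Rogawski, *Automorphic Representations of Unitary Groups in Three Variables* (1990), §8.4 pp. 126–127.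
* [WarnerHASSLG2] G. Warner, *Harmonic Analysis on Semi-Simple Lie Groups II* (1972), §8.5.1 (Thm. 8.5.1.4, Cor. 8.5.1.5: «the manner in which `1` is approached is immaterial»).
-/

set_option autoImplicit false

noncomputable section

open Filter Topology Set Function Metric

/-! ## §1 Generic: a limit within `C` propagates to `closure C ∩ W` wherever the function is continuous -/

namespace Literature.Topology

variable {α β : Type*} [TopologicalSpace α] [PseudoMetricSpace β]

/-- **A LIMIT FROM INSIDE `C` IS THE LIMIT FROM INSIDE `closure C ∩ W` WHEREVER `g` IS CONTINUOUS**: if `g(y) → J` as `y → x` within `C`, and `g` is continuous on the open set `W`, then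
`g(y) → J` as `y → x` within `closure C ∩ W` (at a point `y ∈ closure C ∩ W` near `x`, `g(y)` is a limit of values `g(θ)`, `θ ∈ C` near `y`, all within `ε∕2` of `J`).  Warner: «the manner in which
the point is approached is immaterial». [cite: WarnerHASSLG2, §8.5.1 proof of Thm. 8.5.1.6] -/
theorem tendsto_nhdsWithin_closure_inter_of_continuousOn {g : α → β} {C W : Set α} {x : α} {J : β}
    (hJ : Tendsto g (𝓝[C] x) (𝓝 J)) (hW : IsOpen W) (hg : ContinuousOn g W) :
    Tendsto g (𝓝[closure C ∩ W] x) (𝓝 J) := by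
  rw [Metric.tendsto_nhds] at hJ ⊢
  intro ε hε
  obtain ⟨s, hs, hxs, hsub⟩ := mem_nhdsWithin.1 (hJ (ε / 2) (half_pos hε))
  refine mem_nhdsWithin.2 ⟨s, hs, hxs, ?_⟩
  rintro y ⟨hys, hyC, hyW⟩
  have hyc : y ∈ closure (C ∩ (s ∩ W)) := (hs.inter hW).closure_inter ⟨hyC, hys, hyW⟩
  have hcont : ContinuousWithinAt g (C ∩ (s ∩ W)) y := (hg y hyW).mono fun z hz => hz.2.2
  have himg : g '' (C ∩ (s ∩ W)) ⊆ closedBall J (ε / 2) := by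
    rintro _ ⟨θ, ⟨hθC, hθs, -⟩, rfl⟩
    exact mem_closedBall.2 (le_of_lt (hsub ⟨hθs, hθC⟩))
  have hmem : g y ∈ closedBall J (ε / 2) :=
    closure_minimal himg isClosed_closedBall (hcont.mem_closure_image hyc)
  exact lt_of_le_of_lt (mem_closedBall.1 hmem) (half_lt_self hε)

/-- **Curve form**: under the same hypotheses, along any curve `γ → x` that eventually stays in `closure C ∩ W`, `g ∘ γ → J`. [cite: WarnerHASSLG2, §8.5.1 proof of Thm. 8.5.1.6] -/
theorem tendsto_comp_curve_of_tendsto_nhdsWithin_of_continuousOn {ι : Type*} {g : α → β} {C W : Set α} {x : α} {J : β}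
    (hJ : Tendsto g (𝓝[C] x) (𝓝 J)) (hW : IsOpen W) (hg : ContinuousOn g W) {γ : ι → α} {l : Filter ι}
    (hγ : Tendsto γ l (𝓝 x)) (hγmem : ∀ᶠ v in l, γ v ∈ closure C ∩ W) :
    Tendsto (g ∘ γ) l (𝓝 J) :=
  (tendsto_nhdsWithin_closure_inter_of_continuousOn hJ hW hg).comp (tendsto_nhdsWithin_iff.2 ⟨hγ, hγmem⟩)

end Literature.Topology

namespace Literature.NumberTheory.Rogawski1990

open Literature.Topology

/-! ## §2 Wall points lie in the closure of the adjacent chambers -/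

section Chamber

/-- **Weakly ordered angle vectors are in the closure of the chamber**: `θ(σ0) ≤ θ(σ1) ≤ θ(σ2) ⇒ θ ∈ closure C_σ` (push along `t ↦ θ + t·(rank∘σ⁻¹)`, strictly ordered for `t > 0`).  In particular every
point of the wall `θ(σ0) = θ(σ1) < θ(σ2)` (or `θ(σ0) < θ(σ1) = θ(σ2)`, or the corner) lies in `closure C_σ`. [cite: Rogawski1990, §8.4 p. 126] -/
theorem mem_closure_chamber_of_le (σ : Equiv.Perm (Fin 3)) {θ : Fin 3 → ℝ} (h01 : θ (σ 0) ≤ θ (σ 1)) (h12 : θ (σ 1) ≤ θ (σ 2)) :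
    θ ∈ closure {θ : Fin 3 → ℝ | θ (σ 0) < θ (σ 1) ∧ θ (σ 1) < θ (σ 2)} := by
  have hc : Continuous fun t : ℝ => θ + t • ((Pi.single (σ 1) (1 : ℝ) : Fin 3 → ℝ) + (2 : ℝ) • Pi.single (σ 2) (1 : ℝ)) :=
    continuous_const.add (continuous_id.smul continuous_const)
  have h0 : θ + (0 : ℝ) • ((Pi.single (σ 1) (1 : ℝ) : Fin 3 → ℝ) + (2 : ℝ) • Pi.single (σ 2) (1 : ℝ)) = θ := by simp
  have ht : Tendsto (fun t : ℝ => θ + t • ((Pi.single (σ 1) (1 : ℝ) : Fin 3 → ℝ) + (2 : ℝ) • Pi.single (σ 2) (1 : ℝ))) (𝓝[>] (0 : ℝ)) (𝓝 θ) := by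
    have := (hc.tendsto 0).mono_left (nhdsWithin_le_nhds (s := Ioi (0 : ℝ)))
    rwa [h0] at this
  refine mem_closure_of_tendsto ht ?_
  filter_upwards [self_mem_nhdsWithin] with t ht
  have ht' : (0 : ℝ) < t := ht
  have h20 : σ 2 ≠ σ 0 := fun h => absurd (σ.injective h) (by decide)
  have h10 : σ 1 ≠ σ 0 := fun h => absurd (σ.injective h) (by decide)
  have h12' : σ 1 ≠ σ 2 := fun h => absurd (σ.injective h) (by decide)
  simp only [Pi.add_apply, Pi.smul_apply, smul_eq_mul, Pi.single_eq_same, Pi.single_eq_of_ne h10.symm, Pi.single_eq_of_ne h20.symm,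
    Pi.single_eq_of_ne h12', Pi.single_eq_of_ne h12'.symm]
  constructor <;> nlinarith

end Chamber

/-! ## §3 The corner jet limit of a chamber read along a wall curve -/

section WallToCorner

/-- **THE CORNER LIMIT OF A CHAMBER IS ITS WALL LIMIT** (the (A4) ⟶ socket adapter): let `g` (e.g. `D³(F_Θ∘chart)`, or `ωF_Θ∘chart`, or the 8-ray functional) tend to `J` within the chamber `C_σ`
at the corner and be continuous on an open `W` of angle space (for the compact double-chamber: the (A1) block-separated set, on which `F_Θ` is smooth ACROSS the compact wall).  Then along every
curve `γ → 0` of weakly `σ`-ordered angle vectors staying in `W` — e.g. the compact-wall curve `v ↦ k_v` — `g(γ(v)) → J`.  So the VALUE clause of ★ `of_chamberJetLimits`∕`…JetBounds`∕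
`of_chamberExtensions` (via ★ `tendsto_iteratedFDeriv_nhdsWithin_chamber_of_cornerExtension`) for a compact-adjacent chamber is discharged by the (A4) wall limit `lim_{v→u} ωF_Θ(k_v)`.
[cite: WarnerHASSLG2, §8.5.1 proof of Thm. 8.5.1.6] [cite: Rogawski1990, §8.4 pp. 126–127] -/
theorem tendsto_comp_wallCurve_of_tendsto_nhdsWithin_chamber {β : Type*} [PseudoMetricSpace β] {ι : Type*} (σ : Equiv.Perm (Fin 3))
    {g : (Fin 3 → ℝ) → β} {W : Set (Fin 3 → ℝ)} {J : β}
    (hJ : Tendsto g (𝓝[{θ : Fin 3 → ℝ | θ (σ 0) < θ (σ 1) ∧ θ (σ 1) < θ (σ 2)}] 0) (𝓝 J)) (hW : IsOpen W) (hg : ContinuousOn g W)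
    {γ : ι → (Fin 3 → ℝ)} {l : Filter ι} (hγ : Tendsto γ l (𝓝 0))
    (hγle : ∀ᶠ v in l, γ v (σ 0) ≤ γ v (σ 1) ∧ γ v (σ 1) ≤ γ v (σ 2)) (hγW : ∀ᶠ v in l, γ v ∈ W) :
    Tendsto (g ∘ γ) l (𝓝 J) := by
  refine tendsto_comp_curve_of_tendsto_nhdsWithin_of_continuousOn hJ hW hg hγ ?_
  filter_upwards [hγle, hγW] with v hv hvW
  exact ⟨mem_closure_chamber_of_le σ hv.1 hv.2, hvW⟩

end WallToCorner

end Literature.NumberTheory.Rogawski1990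

end
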